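import Summits.Parity.GeneralizedHardyLittlewood.Theses.LiouvilleShiftedTables
import Summits.Parity.GeneralizedHardyLittlewood.Theorems.TableChowla.Negative.TableChowlaTightness
import Summits.Parity.GeneralizedHardyLittlewood.Theorems.TableChowla.Negative.TableChowlaOfUniformBinaryChowla

/-!
# `TableChowla` (stmt-Parity-14270): equivalent forms and the quantified kill criterion

Support lemmas for the crux `LiouvilleShiftedTables.TableChowla` (cdisprove seat):
* EQUIVALENT FORMS — `tableChowla_iff_withConst` (implicit constants are free),
  `tableChowla_iff_col` (fourth moment of the SHORT column correlations — the Matomäki–Radziwiłł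
  reading), `tableChowla_iff_offDiag` (only the pairs `a ≠ a'` matter);
* KILL CRITERION — `badPairs_card_le` (Chebyshev: a refutation at level `C` needs a structured
  family of `≫ A²/(log x)^C` biased row pairs);
* BOOKKEEPING — `one_le_arg_of_window` (no `Int.toNat` truncation once `|c| + 1 ≤ A`),
  `diag_eq_of_window`, `momentN_eq_diag_add_off`, `rows_mul_cols_sq_le_window`,
  `eventually_log_rpow_le`;
* the junk of the `f`-interface: `tableChowlaFor_neg_iff` (`f ~ −f`), `tableChowlaFor_zero`.
[folklore]
-/

namespace Summit.Parity.GeneralizedHardyLittlewood.Theorems.TableChowla.Negative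

open Finset Real ArithmeticFunction
open Summit.Parity.GeneralizedHardyLittlewood.Theses

noncomputable section

variable {f : ℕ → ℝ} {c : ℤ} {A₁ A₂ B : ℕ}

/-- The `f`-interface identifies `f` with `-f` … -/
theorem tableChowlaFor_neg_iff : TableChowlaFor (fun n => -f n) ↔ TableChowlaFor f := by
  have h : ∀ c x A, moment (fun n => -f n) c x A = moment f c x A := by
    intro c x A
    unfold moment momentN rowCorr
    simp only [neg_mul_neg]
  simp only [TableChowlaFor, h]

/-- … and has the junk inhabitant `f ≡ 0` (so `TableChowlaFor f` carries content only together with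
`|f| = 1`-type information, cf. the floors in (b)). -/
theorem tableChowlaFor_zero : TableChowlaFor (fun _ => 0) := by
  intro c _ δ _ _ C _
  refine ⟨2, fun x hx A _ _ => ?_⟩
  have h0 : moment (fun _ => (0 : ℝ)) c x A = 0 := by simp [moment, momentN, rowCorr]
  rw [h0]
  have hlog : 0 < Real.log x := Real.log_pos (by linarith)
  positivity

/-- The crux with an unspecified multiplicative constant. -/
def TableChowlaWithConst : Prop :=
  ∀ c : ℤ, c ≠ 0 → ∀ δ : ℝ, 0 < δ → δ ≤ 1 / 12 → ∀ C : ℝ, 0 < C → ∃ K x₀ : ℝ, ∀ x : ℝ, x₀ ≤ x →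
    ∀ A : ℝ, x ^ δ ≤ A → A ≤ x ^ (1 / 3 + δ) → moment lam c x A ≤ K * x ^ 2 / Real.log x ^ C

/-- EQUIVALENT FORM 1 — constants are free: `T ≤ K(c,δ,C)·x²/(log x)^C` for every `C` is the same
statement (use `C + 1` and `x ≥ e^K`). Provers may carry implicit constants throughout. -/
theorem tableChowla_iff_withConst : LiouvilleShiftedTables.TableChowla ↔ TableChowlaWithConst := by
  rw [tableChowla_iff]
  constructor
  · intro h c hc δ hδ hδ' C hC
    obtain ⟨x₀, hx₀⟩ := h c hc δ hδ hδ' C hC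
    exact ⟨1, x₀, fun x hx A hA hA' => by rw [one_mul]; exact hx₀ x hx A hA hA'⟩
  · intro h c hc δ hδ hδ' C hC
    obtain ⟨K, x₀, hx₀⟩ := h c hc δ hδ hδ' (C + 1) (by linarith)
    refine ⟨max x₀ (Real.exp (max K 1)), fun x hx A hA hA' => ?_⟩
    have hx₀x : x₀ ≤ x := le_trans (le_max_left _ _) hx
    have hxe : Real.exp (max K 1) ≤ x := le_trans (le_max_right _ _) hx
    have hxpos : 0 < x := (Real.exp_pos _).trans_le hxe
    have hlogK : max K 1 ≤ Real.log x := (Real.le_log_iff_exp_le hxpos).mpr hxe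
    have hlog1 : 1 ≤ Real.log x := le_trans (le_max_right _ _) hlogK
    have hK : K ≤ Real.log x := le_trans (le_max_left _ _) hlogK
    have key := hx₀ x hx₀x A hA hA'
    calc moment lam c x A ≤ K * x ^ 2 / Real.log x ^ (C + 1) := key
      _ ≤ Real.log x * x ^ 2 / Real.log x ^ (C + 1) := by
          gcongr
      _ = x ^ 2 / Real.log x ^ C := by
          rw [Real.rpow_add (by linarith), Real.rpow_one]
          field_simp

/-- EQUIVALENT FORM 2 — by COLUMNS (`momentN_eq_colMoment`): the crux is verbatim the statement
that the fourth moment of the SHORT column correlations `∑_{a ∈ (A,2A]} λ(ab+c) λ(ab'+c)`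
(length `≍ A`, as small as `x^δ`) over pairs of columns `b, b' ≤ x/A` is `≤ x²/(log x)^C` — the
Matomäki–Radziwiłł-type (short multiplicative sums) reading, dual to the Elliott-type reading by rows. -/
theorem tableChowla_iff_col : LiouvilleShiftedTables.TableChowla ↔
    ∀ c : ℤ, c ≠ 0 → ∀ δ : ℝ, 0 < δ → δ ≤ 1 / 12 → ∀ C : ℝ, 0 < C → ∃ x₀ : ℝ, ∀ x : ℝ, x₀ ≤ x →
      ∀ A : ℝ, x ^ δ ≤ A → A ≤ x ^ (1 / 3 + δ) →
        (∑ b ∈ Icc 1 ⌊x / A⌋₊, ∑ b' ∈ Icc 1 ⌊x / A⌋₊, (∑ a ∈ Ioc ⌊A⌋₊ ⌊2 * A⌋₊,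
          lam (Int.toNat ((a : ℤ) * b + c)) * lam (Int.toNat ((a : ℤ) * b' + c))) ^ 2) ≤
          x ^ 2 / Real.log x ^ C := by
  rw [tableChowla_iff]
  have h : ∀ c x A, moment lam c x A = ∑ b ∈ Icc 1 ⌊x / A⌋₊, ∑ b' ∈ Icc 1 ⌊x / A⌋₊,
      (∑ a ∈ Ioc ⌊A⌋₊ ⌊2 * A⌋₊, lam (Int.toNat ((a : ℤ) * b + c)) * lam (Int.toNat ((a : ℤ) * b' + c))) ^ 2 :=
    fun c x A => momentN_eq_colMoment
  simp only [TableChowlaFor, h]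

/-- KILL CRITERION, quantified (Chebyshev): under the crux, beyond `x₀(c,δ,C)` and for `A` in the
window, the number of ROW PAIRS `(a,a')` with `|S(a,a')| ≥ η·B` (`B = ⌊x/A⌋`) times `(ηB)²` is at
most `x²/(log x)^C`; i.e. at most `≍ A²/(η²(log x)^C)` pairs can be `η`-biased. A refutation at
level `C` must exhibit MORE biased pairs than that — a structured family of relative density
`≫ (log x)^{-C}` among the `≍ A²` pairs (numerics: none visible). -/
theorem badPairs_card_le (h : LiouvilleShiftedTables.TableChowla) {c : ℤ} (hc : c ≠ 0) {δ : ℝ}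
    (hδ : 0 < δ) (hδ' : δ ≤ 1 / 12) {C : ℝ} (hC : 0 < C) :
    ∃ x₀ : ℝ, ∀ x : ℝ, x₀ ≤ x → ∀ A : ℝ, x ^ δ ≤ A → A ≤ x ^ (1 / 3 + δ) → ∀ η : ℝ, 0 ≤ η →
      ((((Ioc ⌊A⌋₊ ⌊2 * A⌋₊) ×ˢ (Ioc ⌊A⌋₊ ⌊2 * A⌋₊)).filter (fun p : ℕ × ℕ =>
          η * ⌊x / A⌋₊ ≤ |rowCorr lam c ⌊x / A⌋₊ p.1 p.2|)).card : ℝ) * (η * ⌊x / A⌋₊) ^ 2 ≤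
        x ^ 2 / Real.log x ^ C := by
  obtain ⟨x₀, hx₀⟩ := (tableChowla_iff.mp h) c hc δ hδ hδ' C hC
  refine ⟨x₀, fun x hx A hA hA' η hη => le_trans ?_ (hx₀ x hx A hA hA')⟩
  have hηB : 0 ≤ η * (⌊x / A⌋₊ : ℝ) := mul_nonneg hη (Nat.cast_nonneg _)
  calc ((((Ioc ⌊A⌋₊ ⌊2 * A⌋₊) ×ˢ (Ioc ⌊A⌋₊ ⌊2 * A⌋₊)).filter (fun p : ℕ × ℕ =>
          η * ⌊x / A⌋₊ ≤ |rowCorr lam c ⌊x / A⌋₊ p.1 p.2|)).card : ℝ) * (η * ⌊x / A⌋₊) ^ 2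
        = ∑ _p ∈ ((Ioc ⌊A⌋₊ ⌊2 * A⌋₊) ×ˢ (Ioc ⌊A⌋₊ ⌊2 * A⌋₊)).filter (fun p : ℕ × ℕ =>
            η * ⌊x / A⌋₊ ≤ |rowCorr lam c ⌊x / A⌋₊ p.1 p.2|), (η * ⌊x / A⌋₊) ^ 2 := by
          rw [sum_const, nsmul_eq_mul]
    _ ≤ ∑ p ∈ ((Ioc ⌊A⌋₊ ⌊2 * A⌋₊) ×ˢ (Ioc ⌊A⌋₊ ⌊2 * A⌋₊)).filter (fun p : ℕ × ℕ =>
            η * ⌊x / A⌋₊ ≤ |rowCorr lam c ⌊x / A⌋₊ p.1 p.2|), rowCorr lam c ⌊x / A⌋₊ p.1 p.2 ^ 2 := by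
          refine sum_le_sum fun p hp => ?_
          obtain ⟨_, hp2⟩ := mem_filter.mp hp
          calc (η * ⌊x / A⌋₊) ^ 2 ≤ |rowCorr lam c ⌊x / A⌋₊ p.1 p.2| ^ 2 := pow_le_pow_left₀ hηB hp2 2
            _ = rowCorr lam c ⌊x / A⌋₊ p.1 p.2 ^ 2 := sq_abs _
    _ ≤ ∑ p ∈ (Ioc ⌊A⌋₊ ⌊2 * A⌋₊) ×ˢ (Ioc ⌊A⌋₊ ⌊2 * A⌋₊), rowCorr lam c ⌊x / A⌋₊ p.1 p.2 ^ 2 :=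
          sum_le_sum_of_subset_of_nonneg (filter_subset _ _) fun _ _ _ => sq_nonneg _
    _ = moment lam c x A := by
          unfold moment momentN
          rw [sum_product]

/-- In the window, once `|c| + 1 ≤ A`, every table argument `ab + c` is `≥ 1`
(so `Int.toNat` never truncates and `λ(ab+c) = ±1`). -/
theorem one_le_arg_of_window {A : ℝ} (hcA : (|c| : ℝ) + 1 ≤ A) {a : ℕ} (ha : a ∈ Ioc ⌊A⌋₊ A₂)
    {b : ℕ} (hb : b ∈ Icc 1 B) : 1 ≤ (a : ℤ) * b + c := by
  rw [mem_Ioc] at ha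
  rw [mem_Icc] at hb
  have hA0 : 0 ≤ A := by linarith [abs_nonneg (c : ℝ)]
  have h1 : (⌊A⌋₊ : ℝ) + 1 > A := Nat.lt_floor_add_one A
  have h2 : ((⌊A⌋₊ + 1 : ℕ) : ℝ) ≤ a := by exact_mod_cast ha.1
  have h3 : (|c| : ℝ) + 1 < (a : ℝ) + 1 := by push_cast at h2; linarith
  have h4 : |c| < (a : ℤ) := by
    have : ((|c| : ℤ) : ℝ) < ((a : ℤ) : ℝ) := by push_cast; simpa using h3
    exact_mod_cast this
  have hb1 : (1 : ℤ) ≤ b := by exact_mod_cast hb.1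
  have ha0 : (0 : ℤ) ≤ a := by positivity
  have : (a : ℤ) ≤ (a : ℤ) * b := le_mul_of_one_le_right ha0 hb1
  linarith [neg_abs_le c]

/-- Hence, in the window with `|c| + 1 ≤ A`, the DIAGONAL of the λ-moment is exactly `rows · B²`. -/
theorem diag_eq_of_window {A : ℝ} (hcA : (|c| : ℝ) + 1 ≤ A) :
    ∑ a ∈ Ioc ⌊A⌋₊ A₂, rowCorr lam c B a a ^ 2 = ((A₂ - ⌊A⌋₊ : ℕ) : ℝ) * (B : ℝ) ^ 2 := by
  calc ∑ a ∈ Ioc ⌊A⌋₊ A₂, rowCorr lam c B a a ^ 2 = ∑ _a ∈ Ioc ⌊A⌋₊ A₂, (B : ℝ) ^ 2 :=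
        sum_congr rfl fun a ha => by
          rw [rowCorr_self_eq lam_sq' fun b hb => one_le_arg_of_window hcA ha hb]
    _ = ((A₂ - ⌊A⌋₊ : ℕ) : ℝ) * (B : ℝ) ^ 2 := by simp [Nat.card_Ioc]

/-- Off-diagonal part `∑_{a ≠ a'} S(a,a')²` of the moment. -/
def offMomentN (f : ℕ → ℝ) (c : ℤ) (A₁ A₂ B : ℕ) : ℝ :=
  ∑ a ∈ Ioc A₁ A₂, ∑ a' ∈ (Ioc A₁ A₂).erase a, rowCorr f c B a a' ^ 2

/-- `T = diagonal + off-diagonal`. -/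
theorem momentN_eq_diag_add_off :
    momentN f c A₁ A₂ B = ∑ a ∈ Ioc A₁ A₂, rowCorr f c B a a ^ 2 + offMomentN f c A₁ A₂ B := by
  unfold momentN offMomentN
  rw [← sum_add_distrib]
  exact sum_congr rfl fun a ha => (Finset.add_sum_erase _ _ ha).symm

/-- The off-diagonal part is non-negative. -/
theorem offMomentN_nonneg : 0 ≤ offMomentN f c A₁ A₂ B :=
  sum_nonneg fun _ _ => sum_nonneg fun _ _ => sq_nonneg _

/-- The off-diagonal part is at most the moment. -/
theorem offMomentN_le_momentN : offMomentN f c A₁ A₂ B ≤ momentN f c A₁ A₂ B := by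
  rw [momentN_eq_diag_add_off]
  linarith [sum_nonneg fun a (_ : a ∈ Ioc A₁ A₂) => sq_nonneg (rowCorr f c B a a)]

/-- The crux restricted to the OFF-DIAGONAL pairs `a ≠ a'`. -/
def TableChowlaOffDiag : Prop :=
  ∀ c : ℤ, c ≠ 0 → ∀ δ : ℝ, 0 < δ → δ ≤ 1 / 12 → ∀ C : ℝ, 0 < C → ∃ x₀ : ℝ, ∀ x : ℝ, x₀ ≤ x →
    ∀ A : ℝ, x ^ δ ≤ A → A ≤ x ^ (1 / 3 + δ) →
      offMomentN lam c ⌊A⌋₊ ⌊2 * A⌋₊ ⌊x / A⌋₊ ≤ x ^ 2 / Real.log x ^ C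

/-- Window bookkeeping: `rows · B² ≤ 2x²/x^δ` for `x ≥ 1`, `A` in the window (`rows ≤ 2A`,
`B ≤ x/A`). -/
theorem rows_mul_cols_sq_le_window {x A δ : ℝ} (hx1 : 1 ≤ x) (hδ : 0 ≤ δ) (hA : x ^ δ ≤ A) :
    ((⌊2 * A⌋₊ - ⌊A⌋₊ : ℕ) : ℝ) * (⌊x / A⌋₊ : ℝ) ^ 2 ≤ 2 * x ^ 2 / x ^ δ := by
  have hAone : 1 ≤ A := le_trans (Real.one_le_rpow hx1 hδ) hA
  have hApos : 0 < A := by linarith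
  have hxpos : 0 < x := by linarith
  have hcardR : ((⌊2 * A⌋₊ - ⌊A⌋₊ : ℕ) : ℝ) ≤ 2 * A := by
    rw [Nat.cast_sub (Nat.floor_le_floor (by linarith : A ≤ 2 * A))]
    have h1 : (⌊2 * A⌋₊ : ℝ) ≤ 2 * A := Nat.floor_le (by linarith)
    have h2 : A - 1 < (⌊A⌋₊ : ℝ) := by have := Nat.lt_floor_add_one A; linarith
    linarith
  have hBle : (⌊x / A⌋₊ : ℝ) ≤ x / A := Nat.floor_le (by positivity)
  calc ((⌊2 * A⌋₊ - ⌊A⌋₊ : ℕ) : ℝ) * (⌊x / A⌋₊ : ℝ) ^ 2 ≤ (2 * A) * (x / A) ^ 2 :=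
        mul_le_mul hcardR (pow_le_pow_left₀ (by positivity) hBle 2) (by positivity) (by positivity)
    _ = 2 * x ^ 2 / A := by field_simp
    _ ≤ 2 * x ^ 2 / x ^ δ := div_le_div_of_nonneg_left (by positivity) (by positivity) hA

/-- EVENTUALITY used twice: beyond some `X(δ, C)`, `4 (log x)^C ≤ x^δ` and `2 ≤ log x`. -/
theorem eventually_log_rpow_le {δ : ℝ} (hδ : 0 < δ) (C : ℝ) :
    ∃ X : ℝ, ∀ x : ℝ, X ≤ x → 4 * Real.log x ^ C ≤ x ^ δ ∧ 2 ≤ Real.log x := by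
  have hev : ∀ᶠ x in Filter.atTop, ‖Real.log x ^ C‖ ≤ 1 / 4 * ‖x ^ δ‖ :=
    (isLittleO_log_rpow_rpow_atTop C hδ).bound (by norm_num)
  obtain ⟨X, hX⟩ := Filter.eventually_atTop.mp hev
  refine ⟨max X (Real.exp 2), fun x hx => ?_⟩
  have hxX : X ≤ x := le_trans (le_max_left _ _) hx
  have hxe : Real.exp 2 ≤ x := le_trans (le_max_right _ _) hx
  have hxpos : 0 < x := (Real.exp_pos 2).trans_le hxe
  have hlog2 : 2 ≤ Real.log x := (Real.le_log_iff_exp_le hxpos).mpr hxe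
  have := hX x hxX
  rw [Real.norm_eq_abs, Real.norm_eq_abs, abs_of_nonneg (Real.rpow_nonneg (by linarith) C),
    abs_of_nonneg (Real.rpow_nonneg hxpos.le δ)] at this
  exact ⟨by linarith, hlog2⟩

/-- EQUIVALENT FORM 4 — only the pairs `a ≠ a'` matter: `TableChowla ↔ TableChowlaOffDiag`
(`→`: drop the diagonal; `←`: the diagonal is `≤ rows·B² ≤ 2x²/x^δ ≤ x²/(2(log x)^C)` eventually,
and the off-diagonal statement at `C + 1` gives the other half beyond `log x ≥ 2`). -/
theorem tableChowla_iff_offDiag : LiouvilleShiftedTables.TableChowla ↔ TableChowlaOffDiag := by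
  rw [tableChowla_iff]
  constructor
  · intro h c hc δ hδ hδ' C hC
    obtain ⟨x₀, hx₀⟩ := h c hc δ hδ hδ' C hC
    exact ⟨x₀, fun x hx A hA hA' => le_trans offMomentN_le_momentN (hx₀ x hx A hA hA')⟩
  · intro h c hc δ hδ hδ' C hC
    obtain ⟨x₀, hx₀⟩ := h c hc δ hδ hδ' (C + 1) (by linarith)
    obtain ⟨X, hX⟩ := eventually_log_rpow_le hδ C
    refine ⟨max x₀ (max X 1), fun x hx A hA hA' => ?_⟩
    have hx₀x : x₀ ≤ x := le_trans (le_max_left _ _) hx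
    have hxX : X ≤ x := le_trans (le_trans (le_max_left _ _) (le_max_right _ _)) hx
    have hx1 : 1 ≤ x := le_trans (le_trans (le_max_right _ _) (le_max_right _ _)) hx
    have hxpos : 0 < x := by linarith
    obtain ⟨h4, hlog2⟩ := hX x hxX
    have hlogpos : 0 < Real.log x := by linarith
    set L : ℝ := Real.log x ^ C with hL
    have hLpos : 0 < L := Real.rpow_pos_of_pos hlogpos C
    have hoff := hx₀ x hx₀x A hA hA'
    rw [Real.rpow_add hlogpos, Real.rpow_one, ← hL] at hoff
    -- diagonal ≤ rows B² ≤ 2x²/x^δ ≤ x²/(2L)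
    have hdiag : ∑ a ∈ Ioc ⌊A⌋₊ ⌊2 * A⌋₊, rowCorr lam c ⌊x / A⌋₊ a a ^ 2 ≤
        ((⌊2 * A⌋₊ - ⌊A⌋₊ : ℕ) : ℝ) * (⌊x / A⌋₊ : ℝ) ^ 2 := by
      calc ∑ a ∈ Ioc ⌊A⌋₊ ⌊2 * A⌋₊, rowCorr lam c ⌊x / A⌋₊ a a ^ 2
            ≤ ∑ _a ∈ Ioc ⌊A⌋₊ ⌊2 * A⌋₊, (⌊x / A⌋₊ : ℝ) ^ 2 := by
              refine sum_le_sum fun a _ => ?_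
              have hb := abs_rowCorr_le (c := c) (B := ⌊x / A⌋₊) abs_lam_le_one a a
              exact sq_le_sq' (by linarith [(abs_le.mp hb).1]) (abs_le.mp hb).2
        _ = ((⌊2 * A⌋₊ - ⌊A⌋₊ : ℕ) : ℝ) * (⌊x / A⌋₊ : ℝ) ^ 2 := by simp [Nat.card_Ioc]
    have hwin := rows_mul_cols_sq_le_window hx1 hδ.le hA
    have t2 : 2 * x ^ 2 / x ^ δ ≤ x ^ 2 / (2 * L) := by
      rw [div_le_div_iff₀ (by positivity) (by positivity)]
      nlinarith [mul_le_mul_of_nonneg_right h4 (sq_nonneg x)]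
    have t3 : x ^ 2 / (L * Real.log x) ≤ x ^ 2 / (2 * L) := by
      apply div_le_div_of_nonneg_left (by positivity) (by positivity)
      nlinarith
    have t5 : x ^ 2 / (2 * L) + x ^ 2 / (2 * L) = x ^ 2 / L := by field_simp; ring
    show momentN lam c ⌊A⌋₊ ⌊2 * A⌋₊ ⌊x / A⌋₊ ≤ x ^ 2 / L
    rw [momentN_eq_diag_add_off]
    linarith

end

end Summit.Parity.GeneralizedHardyLittlewood.Theorems.TableChowla.Negative
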